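import Literature.Topology.InvolutionOrbitSpace
import Literature.Topology.FourManifolds.ClosedBallProofs
import Mathlib.Geometry.Manifold.ContMDiff.Atlas
import Mathlib.Geometry.Manifold.ContMDiff.NormedSpace
import HarnessLib

/-!
# `σ`-adapted charts off the real locus (the covering charts of `X → X/σ`)

Topic `Topology/FourManifolds`; namespace `Literature.Topology.FourManifolds.ConjQuotient`.
Companion of `ConjQuotientAtlas.lean`, which builds the smooth structure of the orbit space
`X/σ` from an atlas of `σ`-ADAPTED charts (charts `Φ` of the `C^∞` maximal atlas with
`σ`-invariant source and `Φ ∘ σ = star ∘ Φ`). At a NON-fixed point `x` of the smooth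
involution `σ` such a chart is obtained from any chart `χ₀` at `x` (`exists_freeAdaptedChart`):
choose a small open `U ∋ x` with `U ∩ σ(U) = ∅` (Hausdorff), translate `χ₀` by an imaginary
vector so that `χ = χ₀ + c` has `Im (χ y)₀ > 0` on `U`, and glue `χ|_U` with `star ∘ χ ∘ σ` on
`σ(U)` (disjoint sources, disjoint targets in `{Im w₀ > 0}` and `{Im w₀ < 0}`):
the result is a chart of the maximal atlas, `σ`-adapted, containing no fixed point — the
equivariant form of the covering charts of a free involution (Bredon (1972), I §3; Lee (2013),
Thm. 21.13 for free proper actions). Everything here is folklore.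

## References

* [Bredon1972] G. E. Bredon, *Introduction to compact transformation groups* (1972), I §3.
* [LeeSmoothManifolds2013] J. M. Lee, *Introduction to Smooth Manifolds* (2013), Thm. 21.13.
-/

noncomputable section

open scoped Manifold ContDiff Topology ComplexConjugate
open Set Function Filter Metric
open Literature.Topology.InvolutionOrbitSpace

namespace Literature.Topology.FourManifolds

namespace ConjQuotient

variable {X : Type*} [TopologicalSpace X] [T2Space X] [ChartedSpace (Fin 2 → ℂ) X]
  [IsManifold 𝓘(ℝ, Fin 2 → ℂ) ∞ X] {σ : X → X}

/-- A continuous involution as a self-homeomorphism. [folklore] -/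
def involutionHomeomorph (σ : X → X) (hσ : Involutive σ) (hc : Continuous σ) : X ≃ₜ X where
  toFun := σ
  invFun := σ
  left_inv := hσ
  right_inv := hσ
  continuous_toFun := hc
  continuous_invFun := hc

/-- Coordinatewise conjugation of `ℂ²` as a self-homeomorphism. [folklore] -/
def starHomeomorph : (Fin 2 → ℂ) ≃ₜ (Fin 2 → ℂ) where
  toFun := star
  invFun := star
  left_inv := star_star
  right_inv := star_star
  continuous_toFun := continuous_star
  continuous_invFun := continuous_star

/-- `star` is `C^∞` on `ℂ²` (a real-linear isometry). [folklore] -/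
theorem contMDiff_star :
    ContMDiff 𝓘(ℝ, Fin 2 → ℂ) 𝓘(ℝ, Fin 2 → ℂ) ∞ (star : (Fin 2 → ℂ) → (Fin 2 → ℂ)) :=
  ((starL' ℝ (A := Fin 2 → ℂ) : (Fin 2 → ℂ) ≃L[ℝ] (Fin 2 → ℂ)).contDiff).contMDiff

omit [T2Space X] in
/-- **Translating a chart of the maximal atlas by a constant vector keeps it in the maximal
atlas.** [folklore] -/
theorem exists_translate_chart {χ₀ : OpenPartialHomeomorph X (Fin 2 → ℂ)}
    (hχ₀ : χ₀ ∈ IsManifold.maximalAtlas 𝓘(ℝ, Fin 2 → ℂ) ∞ X) (c : Fin 2 → ℂ) :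
    ∃ χ : OpenPartialHomeomorph X (Fin 2 → ℂ), χ ∈ IsManifold.maximalAtlas 𝓘(ℝ, Fin 2 → ℂ) ∞ X ∧
      χ.source = χ₀.source ∧ (∀ y, χ y = χ₀ y + c) ∧ ∀ w, χ.symm w = χ₀.symm (w - c) := by
  set D : OpenPartialHomeomorph (Fin 2 → ℂ) (Fin 2 → ℂ) :=
    (Homeomorph.addRight c).toOpenPartialHomeomorph with hD
  have hDcoe : ∀ w, D w = w + c := fun w ↦ rfl
  have hDsymm : ∀ w, D.symm w = w + -c := fun w ↦ rfl
  have hDs : ContDiffOn ℝ ∞ D D.source := by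
    rw [show (D : (Fin 2 → ℂ) → (Fin 2 → ℂ)) = fun w ↦ w + c from funext hDcoe]
    exact (contDiff_id.add contDiff_const).contDiffOn
  have hDs' : ContDiffOn ℝ ∞ D.symm D.target := by
    rw [show (D.symm : (Fin 2 → ℂ) → (Fin 2 → ℂ)) = fun w ↦ w + -c from funext hDsymm]
    exact (contDiff_id.add contDiff_const).contDiffOn
  refine ⟨χ₀ ≫ₕ D, trans_mem_maximalAtlas_of_contDiffOn hχ₀ D hDs hDs', ?_, fun y ↦ rfl,
    fun w ↦ ?_⟩
  · rw [OpenPartialHomeomorph.trans_source]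
    simp [hD]
  · show χ₀.symm (D.symm w) = _
    rw [hDsymm, ← sub_eq_add_neg]

/-- **`σ`-adapted charts at non-fixed points.** Let `σ` be a `C^∞` involution of the `C^∞`
manifold `X` (charts in `ℂ²`, Hausdorff) and `x` a point with `σ x ≠ x`. Then there is a chart
`Φ` of the `C^∞` maximal atlas with `x ∈ Φ.source`, `σ`-invariant source containing no fixed
point of `σ`, and `Φ (σ y) = star (Φ y)` on the source (glue a translated chart on a small
`U ∋ x`, `U ∩ σ(U) = ∅`, with `star ∘ χ ∘ σ` on `σ(U)`). [folklore] -/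
theorem exists_freeAdaptedChart (hσ : Involutive σ)
    (hσs : ContMDiff 𝓘(ℝ, Fin 2 → ℂ) 𝓘(ℝ, Fin 2 → ℂ) ∞ σ) {x : X} (hx : σ x ≠ x) :
    ∃ Φ : OpenPartialHomeomorph X (Fin 2 → ℂ),
      Φ ∈ IsManifold.maximalAtlas 𝓘(ℝ, Fin 2 → ℂ) ∞ X ∧ x ∈ Φ.source ∧
      MapsTo σ Φ.source Φ.source ∧ (∀ y ∈ Φ.source, Φ (σ y) = star (Φ y)) ∧
      ∀ y ∈ Φ.source, σ y ≠ y := by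
  classical
  have hσc : Continuous σ := hσs.continuous
  -- a chart at `x` and a small `U ∋ x` with `U ∩ σ(U) = ∅`
  set χ₀ : OpenPartialHomeomorph X (Fin 2 → ℂ) := chartAt (Fin 2 → ℂ) x with hχ₀
  have hχ₀ : χ₀ ∈ IsManifold.maximalAtlas 𝓘(ℝ, Fin 2 → ℂ) ∞ X := IsManifold.chart_mem_maximalAtlas x
  have hxχ₀ : x ∈ χ₀.source := mem_chart_source _ x
  have hN : χ₀.source ∩ χ₀ ⁻¹' ball (χ₀ x) 1 ∈ 𝓝 x :=
    (χ₀.continuousOn.isOpen_inter_preimage χ₀.open_source isOpen_ball).mem_nhds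
      ⟨hxχ₀, by simp⟩
  obtain ⟨U, hUo, hxU, hUN, hU⟩ := exists_nhds_disjoint_image hσc hx hN
  -- translate so that `Im (χ y)₀ > 0` on `U`
  set t : ℝ := |(χ₀ x 0).im| + 2 with ht
  set c : Fin 2 → ℂ := fun k ↦ if k = 0 then Complex.I * t else 0 with hc
  obtain ⟨χ, hχ, hχsrc, hχcoe, hχsymm⟩ := exists_translate_chart hχ₀ c
  have him : ∀ y ∈ U, 0 < (χ y 0).im := by
    intro y hy
    have hyb : χ₀ y ∈ ball (χ₀ x) 1 := (hUN hy).2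
    rw [mem_ball, dist_eq_norm] at hyb
    have h0 : ‖(χ₀ y - χ₀ x) 0‖ < 1 := lt_of_le_of_lt (norm_le_pi_norm _ 0) hyb
    rw [Pi.sub_apply] at h0
    have h1 : |(χ₀ y 0).im - (χ₀ x 0).im| < 1 := by
      have := Complex.abs_im_le_norm ((χ₀ y - χ₀ x) 0)
      simp only [Pi.sub_apply, Complex.sub_im] at this
      linarith
    rw [hχcoe]
    simp only [Pi.add_apply, hc, ↓reduceIte, Complex.add_im, Complex.mul_im, Complex.I_re,
      Complex.I_im, Complex.ofReal_re, Complex.ofReal_im]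
    have := abs_sub_abs_le_abs_sub (χ₀ y 0).im (χ₀ x 0).im
    have h2 : -(1 : ℝ) - |(χ₀ x 0).im| < (χ₀ y 0).im := by
      cases abs_lt.1 h1
      have := neg_abs_le (χ₀ x 0).im
      linarith
    rw [ht]
    nlinarith [abs_nonneg (χ₀ x 0).im]
  have hUχ : U ⊆ χ.source := fun y hy ↦ hχsrc ▸ (hUN hy).1
  -- the two pieces
  set e : OpenPartialHomeomorph X (Fin 2 → ℂ) := χ.restrOpen U hUo with he
  have he_src : e.source = U := by
    rw [he, χ.restrOpen_source]
    exact inter_eq_right.2 hUχ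
  have he_coe : ∀ y, e y = χ y := fun y ↦ rfl
  have he_symm : ∀ w, e.symm w = χ.symm w := fun w ↦ rfl
  have he_tgt : ∀ w ∈ e.target, 0 < (w 0).im := by
    intro w hw
    have hy : e.symm w ∈ U := he_src ▸ e.map_target hw
    have : w = χ (e.symm w) := by rw [he_symm, χ.right_inv (by rw [he] at hw; exact hw.1)]
    rw [this]
    exact him _ hy
  set σH : X ≃ₜ X := involutionHomeomorph σ hσ hσc with hσH
  set e' : OpenPartialHomeomorph X (Fin 2 → ℂ) :=
    (σH.toOpenPartialHomeomorph ≫ₕ e) ≫ₕ starHomeomorph.toOpenPartialHomeomorph with he'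
  have he'_src : e'.source = σ ⁻¹' U := by
    rw [he', OpenPartialHomeomorph.trans_source, OpenPartialHomeomorph.trans_source]
    simp [he_src, hσH, involutionHomeomorph]
  have he'_coe : ∀ y, e' y = star (χ (σ y)) := fun y ↦ rfl
  have he'_symm : ∀ w, e'.symm w = σ (χ.symm (star w)) := fun w ↦ rfl
  have he'_tgt : ∀ w ∈ e'.target, (w 0).im < 0 := by
    intro w hw
    rw [he', OpenPartialHomeomorph.trans_target] at hw
    have hsw : star w ∈ e.target := by
      have := hw.2
      simp only [mem_preimage, OpenPartialHomeomorph.trans_target] at this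
      exact this.1
    have := he_tgt _ hsw
    simpa using this
  -- disjointness
  have Hs : Disjoint e.source e'.source := by
    rw [he_src, he'_src, disjoint_iff_forall_ne]
    rintro y hy _ hy' rfl
    exact hU _ hy hy'
  have Ht : Disjoint e.target e'.target := by
    rw [disjoint_iff_forall_ne]
    rintro w hw _ hw' rfl
    exact lt_asymm (he_tgt w hw) (he'_tgt w hw')
  set Φ : OpenPartialHomeomorph X (Fin 2 → ℂ) := e.disjointUnion e' Hs Ht with hΦ
  have hΦsrc : Φ.source = U ∪ σ ⁻¹' U := by rw [← he'_src, ← he_src]; rfl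
  have hΦe : ∀ y ∈ U, Φ y = χ y := fun y hy ↦ by
    show e.source.piecewise e e' y = _
    rw [piecewise_eq_of_mem _ _ _ (he_src ▸ hy), he_coe]
  have hΦe' : ∀ y ∈ σ ⁻¹' U, Φ y = star (χ (σ y)) := fun y hy ↦ by
    show e.source.piecewise e e' y = _
    have hy' : y ∉ e.source := fun h ↦ hU _ (he_src ▸ h) hy
    rw [piecewise_eq_of_notMem _ _ _ hy', he'_coe]
  have hΦsymm_e : ∀ w ∈ e.target, Φ.symm w = χ.symm w := fun w hw ↦ by
    show e.target.piecewise e.symm e'.symm w = _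
    rw [piecewise_eq_of_mem _ _ _ hw, he_symm]
  have hΦsymm_e' : ∀ w ∈ e'.target, Φ.symm w = σ (χ.symm (star w)) := fun w hw ↦ by
    show e.target.piecewise e.symm e'.symm w = _
    have hw' : w ∉ e.target := fun h ↦ Ht.ne_of_mem h hw rfl
    rw [piecewise_eq_of_notMem _ _ _ hw', he'_symm]
  have hΦtgt : Φ.target = e.target ∪ e'.target := rfl
  -- `σ`-invariance and adaptedness
  have hmaps : MapsTo σ Φ.source Φ.source := by
    intro y hy
    rw [hΦsrc] at hy ⊢
    rcases hy with hy | hy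
    · right; show σ (σ y) ∈ U; rwa [hσ y]
    · left; exact hy
  have hstar : ∀ y ∈ Φ.source, Φ (σ y) = star (Φ y) := by
    intro y hy
    rw [hΦsrc] at hy
    rcases hy with hy | hy
    · have hσy : σ y ∈ σ ⁻¹' U := show σ (σ y) ∈ U by rwa [hσ y]
      rw [hΦe' _ hσy, hΦe _ hy, hσ y]
    · have hσy : σ y ∈ U := hy
      rw [hΦe _ hσy, hΦe' _ hy, star_star]
  have hfree : ∀ y ∈ Φ.source, σ y ≠ y := by
    intro y hy hfix
    rw [hΦsrc] at hy
    rcases hy with hy | hy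
    · exact hU y hy (by rwa [hfix])
    · exact hU (σ y) hy (by rw [hσ y, ← hfix]; exact hy)
  -- smoothness: membership in the maximal atlas
  have hΦmax : Φ ∈ IsManifold.maximalAtlas 𝓘(ℝ, Fin 2 → ℂ) ∞ X := by
    rw [IsManifold.mem_maximalAtlas_iff_contMDiffOn]
    constructor
    · apply contMDiffOn_of_locally_contMDiffOn
      intro y hy
      rw [hΦsrc] at hy
      rcases hy with hy | hy
      · refine ⟨U, hUo, hy, ?_⟩
        have h1 : ContMDiffOn 𝓘(ℝ, Fin 2 → ℂ) 𝓘(ℝ, Fin 2 → ℂ) ∞ χ U :=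
          (contMDiffOn_of_mem_maximalAtlas hχ).mono hUχ
        exact (h1.mono inter_subset_right).congr fun y' hy' ↦ hΦe y' hy'.2
      · refine ⟨σ ⁻¹' U, hUo.preimage hσc, hy, ?_⟩
        have h1 : ContMDiffOn 𝓘(ℝ, Fin 2 → ℂ) 𝓘(ℝ, Fin 2 → ℂ) ∞ (fun y' ↦ star (χ (σ y')))
            (σ ⁻¹' U) :=
          contMDiff_star.comp_contMDiffOn
            ((contMDiffOn_of_mem_maximalAtlas hχ).comp hσs.contMDiffOn fun y' hy' ↦ hUχ hy')
        exact (h1.mono inter_subset_right).congr fun y' hy' ↦ hΦe' y' hy'.2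
    · apply contMDiffOn_of_locally_contMDiffOn
      intro w hw
      rw [hΦtgt] at hw
      rcases hw with hw | hw
      · refine ⟨e.target, e.open_target, hw, ?_⟩
        have hsub : e.target ⊆ χ.target := fun w' hw' ↦ by rw [he] at hw'; exact hw'.1
        have h1 : ContMDiffOn 𝓘(ℝ, Fin 2 → ℂ) 𝓘(ℝ, Fin 2 → ℂ) ∞ χ.symm e.target :=
          (contMDiffOn_symm_of_mem_maximalAtlas hχ).mono hsub
        exact (h1.mono inter_subset_right).congr fun w' hw' ↦ hΦsymm_e w' hw'.2
      · refine ⟨e'.target, e'.open_target, hw, ?_⟩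
        have hsub : ∀ w' ∈ e'.target, star w' ∈ χ.target := by
          intro w' hw'
          rw [he', OpenPartialHomeomorph.trans_target] at hw'
          have := hw'.2
          simp only [mem_preimage, OpenPartialHomeomorph.trans_target] at this
          have h := this.1
          rw [he] at h
          exact h.1
        have h1 : ContMDiffOn 𝓘(ℝ, Fin 2 → ℂ) 𝓘(ℝ, Fin 2 → ℂ) ∞
            (fun w' ↦ σ (χ.symm (star w'))) e'.target :=
          hσs.comp_contMDiffOn ((contMDiffOn_symm_of_mem_maximalAtlas hχ).comp
            contMDiff_star.contMDiffOn hsub)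
        exact (h1.mono inter_subset_right).congr fun w' hw' ↦ hΦsymm_e' w' hw'.2
  exact ⟨Φ, hΦmax, by rw [hΦsrc]; exact Or.inl hxU, hmaps, hstar, hfree⟩

end ConjQuotient

end Literature.Topology.FourManifolds

end
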